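import Mathlib
import Literature.AlgebraicGeometry.Resolution.CobordantGame
import Literature.AlgebraicGeometry.Resolution.CobordantChartCoefficients
import Literature.AlgebraicGeometry.Resolution.CobordantChartPlaneSlice
import Literature.AlgebraicGeometry.Resolution.CobordantTupleGame
import Literature.AlgebraicGeometry.Resolution.CobordantArcLemma
import Literature.AlgebraicGeometry.Resolution.FormalCoordinateChange
import Summits.ResolutionOfSingularities.ResolutionOfSingularities.Theorems.WeightedInvariantGlobalizeLocalDropCanonize
import Summits.ResolutionOfSingularities.ResolutionOfSingularities.Theorems.WeightedInvariantGlobalizeLocalDropRegularGerms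
import Summits.ResolutionOfSingularities.ResolutionOfSingularities.Theorems.WeightedInvariantLocalWeightedDropConeDichotomyAux
import Summits.ResolutionOfSingularities.ResolutionOfSingularities.Theorems.WeightedInvariantLocalWeightedDropTangentConeCut
import Summits.ResolutionOfSingularities.ResolutionOfSingularities.Theorems.WeightedInvariantLocalWeightedDropPlaneBranchDropOfCount
import Summits.ResolutionOfSingularities.ResolutionOfSingularities.Theorems.WeightedInvariantLocalWeightedDropMonicCurveBlowup
import Summits.ResolutionOfSingularities.ResolutionOfSingularities.Theorems.WeightedInvariantLocalWeightedDropMonicDoublePointLift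

/-!
# `WeightedInvariant.LocalWeightedDrop`, line `hasse-ridge-face-selection`: the curve step on a monic double point `y² + A₀(x₀,x₁)`
# (toolkit for the TERMINAL double points)

Crux item stmt-ResolutionOfSingularities-8899 `LocalWeightedDrop` (route `ResolutionOfSingularities/WeightedInvariant`),
serving the door `WeightedConstruction` stmt-ResolutionOfSingularities-0571.  [OURS · L1 W4.3, chain w43, stub worker 3
(gen 2): toolkit for the TERMINAL CASES piece S2iT `stub_charTwoInseparableTerminalWon` of the planner's skeleton draft v21
(CORE W″ piece S2 `stub_charTwoDoublePointSurfaceWon`); NOT a statement of any manuscript.]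

Contents (every field `k`; the curve step in every characteristic `p`):
* coefficients of `y² + A₀` (`y = X (Fin.last 2)`, `A₀ ∈ k[[x₀,x₁]]` embedded along `Fin.succAboveEmb (Fin.last 2)`) in the
  old variables (`coeff_embDomain_dp`, `coeff_single_castSucc_dp`); a singular `y² + A₀` has no linear terms
  (`coeff_single_one_eq_zero_of_isSingular`); `y² + x_l · unit` is not singular (`not_isSingular_dp_linear`);
* THE HYPERBOLIC BOTTOM `won_dp_hyperbolic`: `y² + x₀x₁ · U`, `U(0) ≠ 0`, is won from the one-variable germs
  (`TangentConeCut.hyperbolicStartsWon` with the identity witness);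
* THE COMPOSITE «blow up `V(x_i, y)`, pass to the exceptional point `c_i = c`, slice `x_i' ↦ 0`» on the old variables IS the
  linear substitution `ρ_i : x_i ↦ c · x₀, x_{1-i} ↦ x₁` (`slice_subst_chart`), with its action on unit monomials
  (`subst_rho_zero_unitMonomial`, `subst_rho_one_unitMonomial`), on `x_i^n · g` (`subst_rho_X_pow_mul`) and on linear
  coefficients (`coeff_single_zero_subst_rho`, `coeff_single_one_subst_rho`);
* THE CURVE STEP `won_dp_of_curveStep`: if `A₀ = x_i² · A₀'` with `A₀'(0) = 0`, then — by the landed brick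
  `won_monic_of_curveBlowup` (weights `1` at `x_i`, `y`; every exceptional point tame) — `y² + A₀` is won as soon as every
  SINGULAR slice `y² + c² · A₀'(ρ_i)` (`c ≠ 0`) is won.
-/

set_option linter.dupNamespace false -- mandated namespace of this single-conjunct summit

namespace Summit.ResolutionOfSingularities.ResolutionOfSingularities.Theorems

open Literature.AlgebraicGeometry.Resolution
open Literature.AlgebraicGeometry.Resolution.CobordantGame

namespace TerminalDoublePoint

open MvPowerSeries

variable {k : Type} [Field k]

/-! ### Coefficients of the monic double point `y² + A₀(x₀, x₁)` in the old variables -/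

/-- Exponents of the old variables, embedded along `Fin.succAbove (Fin.last 2)`: `x_l^n ↦ X_{castSucc l}^n`. -/
theorem embDomain_single (l : Fin 2) (n : ℕ) :
    Finsupp.embDomain (Fin.succAboveEmb (Fin.last 2)) (Finsupp.single l n) = Finsupp.single (Fin.castSucc l) n := by
  rw [Finsupp.embDomain_single, Fin.coe_succAboveEmb, Fin.succAbove_last]

/-- The coefficient of `y² + A₀` at a `y`-free exponent `x^β` is the coefficient of `A₀` at `β`. -/
theorem coeff_embDomain_dp (A₀ : MvPowerSeries (Fin 2) k) (β : Fin 2 →₀ ℕ) :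
    coeff (Finsupp.embDomain (Fin.succAboveEmb (Fin.last 2)) β)
        (X (Fin.last 2) ^ 2 + rename (Fin.succAboveEmb (Fin.last 2)) A₀) = coeff β A₀ := by
  classical
  rw [map_add, coeff_embDomain_rename, coeff_X_pow, if_neg, zero_add]
  intro h
  have h2 := congrArg (fun e => e (Fin.last 2)) h
  simp only [Finsupp.single_eq_same] at h2
  rw [Finsupp.embDomain_notin_range _ _ _ (by simp)] at h2
  exact absurd h2 (by norm_num)

/-- The coefficient of `y² + A₀` at `x_l^n` is the coefficient of `A₀` at `x_l^n`. -/
theorem coeff_single_castSucc_dp (A₀ : MvPowerSeries (Fin 2) k) (l : Fin 2) (n : ℕ) :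
    coeff (Finsupp.single (Fin.castSucc l) n) (X (Fin.last 2) ^ 2 + rename (Fin.succAboveEmb (Fin.last 2)) A₀) =
      coeff (Finsupp.single l n) A₀ := by
  rw [← embDomain_single, coeff_embDomain_dp]

/-- A SINGULAR `y² + A₀` has no linear terms: the linear coefficients of `A₀` vanish. -/
theorem coeff_single_one_eq_zero_of_isSingular {A₀ : MvPowerSeries (Fin 2) k}
    (hS : CobordantGame.IsSingular k (X (Fin.last 2) ^ 2 + rename (Fin.succAboveEmb (Fin.last 2)) A₀)) (l : Fin 2) :
    coeff (Finsupp.single l 1) A₀ = 0 := by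
  rw [← coeff_single_castSucc_dp A₀ l 1]
  exact hS.2.2 _

/-- `x₀^r x₁^s` is the monomial at `r·e₀ + s·e₁`. -/
theorem X_pow_mul_X_pow_eq (r s : ℕ) :
    (X 0 ^ r * X 1 ^ s : MvPowerSeries (Fin 2) k) = monomial (Finsupp.single 0 r + Finsupp.single 1 s) 1 := by
  rw [X_pow_eq, X_pow_eq, monomial_mul_monomial, one_mul]

/-- The coefficient of `x₀^r x₁^s · U` at `x₀^r x₁^s` is `U(0)`. -/
theorem coeff_unitMonomial_self (r s : ℕ) (U : MvPowerSeries (Fin 2) k) :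
    coeff (Finsupp.single 0 r + Finsupp.single 1 s) (X 0 ^ r * X 1 ^ s * U) = constantCoeff U := by
  classical
  rw [X_pow_mul_X_pow_eq, coeff_monomial_mul, if_pos le_rfl, tsub_self, one_mul, coeff_zero_eq_constantCoeff_apply]

/-- `y² + x_l · U` with `U(0) ≠ 0` is NOT singular (it has the linear term `U(0) · x_l`). -/
theorem not_isSingular_dp_linear (l : Fin 2) {U : MvPowerSeries (Fin 2) k} (hU : constantCoeff U ≠ 0) :
    ¬ CobordantGame.IsSingular k (X (Fin.last 2) ^ 2 + rename (Fin.succAboveEmb (Fin.last 2)) (X l * U)) := by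
  intro hS
  have h := coeff_single_one_eq_zero_of_isSingular hS l
  rw [X_def, coeff_monomial_mul, if_pos le_rfl, tsub_self, one_mul, coeff_zero_eq_constantCoeff_apply] at h
  exact hU h

/-- THE HYPERBOLIC BOTTOM `y² + x₀ x₁ · U` (`U(0) ≠ 0`): won from the one-variable germs by `TangentConeCut.hyperbolicStartsWon`
(identity witness: no `x₀²`, no `x₁²`, the `x₀x₁`-coefficient is `U(0)`). -/
theorem won_dp_hyperbolic (hlow : ∀ g : MvPowerSeries (Fin 1) k, CobordantGame.IsSingular k g → CobordantGame.Won k 1 g)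
    {U : MvPowerSeries (Fin 2) k} (hU : constantCoeff U ≠ 0) :
    CobordantGame.Won k 3 (X (Fin.last 2) ^ 2 + rename (Fin.succAboveEmb (Fin.last 2)) (X 0 ^ 1 * X 1 ^ 1 * U)) := by
  classical
  set S : MvPowerSeries (Fin 3) k := X (Fin.last 2) ^ 2 + rename (Fin.succAboveEmb (Fin.last 2)) (X 0 ^ 1 * X 1 ^ 1 * U)
    with hSdef
  by_cases hS : CobordantGame.IsSingular k S
  · refine TangentConeCut.hyperbolicStartsWon (n := 0) hlow S hS ⟨X, fun i => constantCoeff_X i, ?_, ?_, ?_, ?_⟩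
    · rw [← FormalCoordChange.linSubst_one, ConeDichotomy.linMat_linSubst, Matrix.det_one]
      exact isUnit_one
    · have hself : subst (X : Fin 3 → MvPowerSeries (Fin 3) k) S = S := by rw [subst_self]; rfl
      rw [hself, hSdef, show (Finsupp.single (0 : Fin 3) 2) = Finsupp.single (Fin.castSucc (0 : Fin 2)) 2 from rfl,
        coeff_single_castSucc_dp]
      have hdvd : (X 1 : MvPowerSeries (Fin 2) k) ∣ X 0 ^ 1 * X 1 ^ 1 * U :=
        ⟨X 0 ^ 1 * U, by ring⟩
      exact X_dvd_iff.mp hdvd _ (by rw [Finsupp.single_apply, if_neg (by decide)])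
    · have hself : subst (X : Fin 3 → MvPowerSeries (Fin 3) k) S = S := by rw [subst_self]; rfl
      rw [hself, hSdef, show (Finsupp.single (1 : Fin 3) 2) = Finsupp.single (Fin.castSucc (1 : Fin 2)) 2 from rfl,
        coeff_single_castSucc_dp]
      have hdvd : (X 0 : MvPowerSeries (Fin 2) k) ∣ X 0 ^ 1 * X 1 ^ 1 * U :=
        ⟨X 1 ^ 1 * U, by ring⟩
      exact X_dvd_iff.mp hdvd _ (by rw [Finsupp.single_apply, if_neg (by decide)])
    · have hself : subst (X : Fin 3 → MvPowerSeries (Fin 3) k) S = S := by rw [subst_self]; rfl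
      have hexp : (Finsupp.single (0 : Fin 3) 1 + Finsupp.single (1 : Fin 3) 1) =
          Finsupp.embDomain (Fin.succAboveEmb (Fin.last 2)) (Finsupp.single 0 1 + Finsupp.single 1 1) := by
        rw [Finsupp.embDomain_add, embDomain_single, embDomain_single]
        rfl
      rw [hself, hSdef, hexp, coeff_embDomain_dp, coeff_unitMonomial_self]
      exact hU
  · exact (wonBy_zero_of_not_isSingular (by norm_num) hS).won

/-! ### The composite «curve chart, then slice» is a linear substitution -/

/-- The linear substitution `ρ_i = (x_i ↦ c x₀, x_{1-i} ↦ x₁)` has zero constant terms. -/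
theorem constantCoeff_rho (i : Fin 2) (c : k) (l : Fin 2) :
    constantCoeff ((fun l : Fin 2 => if l = i then C c * X 0 else (X 1 : MvPowerSeries (Fin 2) k)) l) = 0 := by
  dsimp only
  split_ifs <;> simp [constantCoeff_X]

/-- `ρ_i` is substitutable. -/
theorem hasSubst_rho (i : Fin 2) (c : k) :
    HasSubst (fun l : Fin 2 => if l = i then C c * X 0 else (X 1 : MvPowerSeries (Fin 2) k)) :=
  hasSubst_of_constantCoeff_zero (constantCoeff_rho i c)

/-- THE COMPOSITE «blow up `V(x_i, y)`, go to the exceptional point `c_i = c`, slice `x_i' ↦ 0`» on the old variables IS the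
linear substitution `x_i ↦ c · x₀`, `x_{1-i} ↦ x₁` (the exceptional variable `s` becomes `x₀`). -/
theorem slice_subst_chart (i : Fin 2) (c : k) (F : MvPowerSeries (Fin 2) k) :
    TupleGame.slice i (subst (CobordantChart.chart (fun l : Fin 2 => if l = i then 1 else 0)
        (fun l : Fin 2 => if l = i then c else 0)) F) =
      subst (fun l : Fin 2 => if l = i then C c * X 0 else (X 1 : MvPowerSeries (Fin 2) k)) F := by
  have hc : ∀ l : Fin 2, (fun l : Fin 2 => if l = i then (1 : ℕ) else 0) l = 0 →
      (fun l : Fin 2 => if l = i then c else 0) l = 0 := by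
    intro l hl
    dsimp only at hl ⊢
    by_cases h : l = i
    · rw [if_pos h] at hl
      exact absurd hl one_ne_zero
    · rw [if_neg h]
  have hch := CobordantChart.hasSubst_chart _ _ hc
  have hsl := CobordantChartPlaneSlice.hasSubst_slice (R := k) (n := 2) i
  unfold TupleGame.slice
  rw [subst_comp_subst_apply hch hsl]
  congr 1
  funext l
  rw [CobordantChart.chart_apply]
  by_cases hl : l = i
  · subst hl
    rw [if_pos rfl, if_pos rfl, pow_one, subst_mul hsl, subst_add hsl, subst_C,
      PlaneBranchDropOfCount.subst_slice_X_zero, PlaneBranchDropOfCount.subst_slice_X_succ_self, add_zero, mul_comm,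
      if_pos rfl]
  · rw [if_neg hl, if_neg hl, pow_zero, one_mul, map_zero, zero_add,
      PlaneBranchDropOfCount.subst_slice_X_succ_of_ne hl, if_neg hl]

/-- `ρ_i` at the zero series is zero. -/
theorem subst_rho_zero (i : Fin 2) (c : k) :
    subst (fun l : Fin 2 => if l = i then C c * X 0 else (X 1 : MvPowerSeries (Fin 2) k)) (0 : MvPowerSeries (Fin 2) k) = 0 := by
  rw [← coe_substAlgHom (hasSubst_rho i c), map_zero]

/-- `ρ_i` does not change constant terms. -/
theorem constantCoeff_subst_rho (i : Fin 2) (c : k) (U : MvPowerSeries (Fin 2) k) :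
    constantCoeff (subst (fun l : Fin 2 => if l = i then C c * X 0 else (X 1 : MvPowerSeries (Fin 2) k)) U) =
      constantCoeff U :=
  constantCoeff_subst_of_constantCoeff_zero _ (constantCoeff_rho i c) U

/-- `ρ₀` on a unit monomial: `(x₀^r x₁^s U)(c x₀, x₁) = x₀^r x₁^s · (c^r · U(c x₀, x₁))`. -/
theorem subst_rho_zero_unitMonomial (c : k) (r s : ℕ) (U : MvPowerSeries (Fin 2) k) :
    subst (fun l : Fin 2 => if l = 0 then C c * X 0 else (X 1 : MvPowerSeries (Fin 2) k)) (X 0 ^ r * X 1 ^ s * U) =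
      X 0 ^ r * X 1 ^ s *
        (C (c ^ r) * subst (fun l : Fin 2 => if l = 0 then C c * X 0 else (X 1 : MvPowerSeries (Fin 2) k)) U) := by
  have hs := hasSubst_rho (k := k) 0 c
  rw [subst_mul hs, subst_mul hs, subst_pow hs, subst_pow hs, subst_X hs, subst_X hs, if_pos rfl,
    if_neg one_ne_zero, mul_pow, ← map_pow]
  ring

/-- `ρ₁` on a unit monomial: `(x₀^r x₁^s U)(x₁, c x₀) = x₀^s x₁^r · (c^s · U(x₁, c x₀))`. -/
theorem subst_rho_one_unitMonomial (c : k) (r s : ℕ) (U : MvPowerSeries (Fin 2) k) :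
    subst (fun l : Fin 2 => if l = 1 then C c * X 0 else (X 1 : MvPowerSeries (Fin 2) k)) (X 0 ^ r * X 1 ^ s * U) =
      X 0 ^ s * X 1 ^ r *
        (C (c ^ s) * subst (fun l : Fin 2 => if l = 1 then C c * X 0 else (X 1 : MvPowerSeries (Fin 2) k)) U) := by
  have hs := hasSubst_rho (k := k) 1 c
  rw [subst_mul hs, subst_mul hs, subst_pow hs, subst_pow hs, subst_X hs, subst_X hs, if_neg zero_ne_one,
    if_pos rfl, mul_pow, ← map_pow]
  ring

/-- `ρ_i` on `x_i^n · g`: `x₀^n · (c^n · g(ρ_i))`. -/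
theorem subst_rho_X_pow_mul (i : Fin 2) (c : k) (n : ℕ) (g : MvPowerSeries (Fin 2) k) :
    subst (fun l : Fin 2 => if l = i then C c * X 0 else (X 1 : MvPowerSeries (Fin 2) k)) (X i ^ n * g) =
      X 0 ^ n * (C (c ^ n) * subst (fun l : Fin 2 => if l = i then C c * X 0 else (X 1 : MvPowerSeries (Fin 2) k)) g) := by
  have hs := hasSubst_rho (k := k) i c
  rw [subst_mul hs, subst_pow hs, subst_X hs, if_pos rfl, mul_pow, ← map_pow]
  ring

/-- LINEAR COEFFICIENTS UNDER `ρ_i`, new slot `x₀`: `[x₀] g(ρ_i) = c · [x_i] g`. -/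
theorem coeff_single_zero_subst_rho (i : Fin 2) (c : k) (g : MvPowerSeries (Fin 2) k) :
    coeff (Finsupp.single 0 1) (subst (fun l : Fin 2 => if l = i then C c * X 0 else (X 1 : MvPowerSeries (Fin 2) k)) g) =
      c * coeff (Finsupp.single i 1) g := by
  classical
  rw [CobordantArc.coeff_degree_one_subst _ (constantCoeff_rho i c) g _ (Finsupp.degree_single _ _), Fin.sum_univ_two]
  fin_cases i
  · simp [coeff_X, Finsupp.single_left_inj one_ne_zero, mul_comm]
  · simp [coeff_X, Finsupp.single_left_inj one_ne_zero, mul_comm]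

/-- LINEAR COEFFICIENTS UNDER `ρ_i`, new slot `x₁`: `[x₁] g(ρ_i) = [x_j] g` for the other old slot `j ≠ i`. -/
theorem coeff_single_one_subst_rho (i j : Fin 2) (hji : j ≠ i) (c : k) (g : MvPowerSeries (Fin 2) k) :
    coeff (Finsupp.single 1 1) (subst (fun l : Fin 2 => if l = i then C c * X 0 else (X 1 : MvPowerSeries (Fin 2) k)) g) =
      coeff (Finsupp.single j 1) g := by
  classical
  rw [CobordantArc.coeff_degree_one_subst _ (constantCoeff_rho i c) g _ (Finsupp.degree_single _ _), Fin.sum_univ_two]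
  fin_cases i <;> fin_cases j
  · exact absurd rfl hji
  · simp [coeff_X, Finsupp.single_left_inj one_ne_zero]
  · simp [coeff_X, Finsupp.single_left_inj one_ne_zero]
  · exact absurd rfl hji

/-! ### The curve step on `y² + A₀` -/

/-- THE CURVE STEP.  If `A₀ = x_i² · A₀'` with `A₀'(0) = 0`, blowing up `V(x_i, y)` (`won_monic_of_curveBlowup`) wins `y² + A₀` as
soon as every SINGULAR slice `y² + c² · A₀'(ρ_i)` (`c ≠ 0`) is won. -/
theorem won_dp_of_curveStep (p : ℕ) (hp : p.Prime) (k : Type) [Field k] [CharP k p] (i : Fin 2)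
    (A₀ A₀' : MvPowerSeries (Fin 2) k) (hdiv : A₀ = X i ^ 2 * A₀') (h0 : constantCoeff A₀' = 0)
    (hsucc : ∀ c : k, c ≠ 0 →
      CobordantGame.IsSingular k (X (Fin.last 2) ^ 2 + rename (Fin.succAboveEmb (Fin.last 2))
        (C (c ^ 2) * subst (fun l : Fin 2 => if l = i then C c * X 0 else (X 1 : MvPowerSeries (Fin 2) k)) A₀')) →
      CobordantGame.Won k 3 (X (Fin.last 2) ^ 2 + rename (Fin.succAboveEmb (Fin.last 2))
        (C (c ^ 2) * subst (fun l : Fin 2 => if l = i then C c * X 0 else (X 1 : MvPowerSeries (Fin 2) k)) A₀'))) :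
    CobordantGame.Won k 3 (X (Fin.last 2) ^ 2 + rename (Fin.succAboveEmb (Fin.last 2)) A₀) := by
  classical
  have hform : X (Fin.last 2) ^ 2 + rename (Fin.succAboveEmb (Fin.last 2)) A₀ =
      X (Fin.last 2) ^ 2 + ∑ j : Fin 2, rename (Fin.succAboveEmb (Fin.last 2))
        ((![A₀, 0] : Fin 2 → MvPowerSeries (Fin 2) k) j) * X (Fin.last 2) ^ (j : ℕ) := by
    rw [← MonicDoublePointLift.monic_two_eq_sum A₀ 0, map_zero, zero_mul, add_zero]
  rw [hform]
  refine won_monic_of_curveBlowup p hp k 2 2 two_pos i (![A₀, 0]) (![A₀', 0]) ?_ ?_ ?_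
  · intro j
    fin_cases j
    · simpa using hdiv
    · simp
  · intro j
    fin_cases j
    · simpa using h0
    · simp
  · intro c hc hS
    have hSeq : X (Fin.last 2) ^ 2 + ∑ j : Fin 2, rename (Fin.succAboveEmb (Fin.last 2))
        (C (c ^ (2 - (j : ℕ))) * TupleGame.slice i (subst (CobordantChart.chart (fun l : Fin 2 => if l = i then 1 else 0)
          (fun l : Fin 2 => if l = i then c else 0)) ((![A₀', 0] : Fin 2 → MvPowerSeries (Fin 2) k) j))) *
          X (Fin.last 2) ^ (j : ℕ) =
        X (Fin.last 2) ^ 2 + rename (Fin.succAboveEmb (Fin.last 2))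
          (C (c ^ 2) * subst (fun l : Fin 2 => if l = i then C c * X 0 else (X 1 : MvPowerSeries (Fin 2) k)) A₀') := by
      rw [Fin.sum_univ_two]
      simp only [Matrix.cons_val_zero, Matrix.cons_val_one, Fin.val_zero, Fin.val_one,
        Nat.sub_zero, pow_zero, mul_one, slice_subst_chart, subst_rho_zero, mul_zero, map_zero, zero_mul, add_zero]
    rw [hSeq] at hS ⊢
    exact hsucc c hc hS

end TerminalDoublePoint

end Summit.ResolutionOfSingularities.ResolutionOfSingularities.Theorems
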